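import Literature.MathematicalPhysics.KineticTheory.HardSphereEulerProofs
import Literature.MathematicalPhysics.KineticTheory.HardSphereBBGKYLiouvilleFlow
import HarnessLib

/-!
# EnskogAdjointDuality / DualityReduction — helper 2: velocity moments of the local Gibbs laws

Support lemmas for `Summit.AtomisticToContinuum.HydrodynamicLimit.Theses.EnskogAdjointDuality.DualityReduction`
(stmt-AtomisticToContinuum-11590). Every `L²` bound of the duality argument is paid for by the
conserved kinetic energy per particle `e(z) = (N+1)⁻¹ Σᵢ |vᵢ|²`; this file bounds
`∫ (1 + e)^4 dP_N` uniformly in `N` under the local Gibbs laws (conditionally on the positions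
the velocities are independent Gaussians `N(u₀(xᵢ), θ₀(xᵢ) id)`, `lintegral_localGibbsMeasure`;
Gaussian moments of every order are finite by Fernique, and uniform for `‖u‖ ≤ U`, `θ ≤ Θ`), and
transports the bound to every time along any hard-sphere flow (energy conservation on the good
set, which carries the law).

* `integral_norm_pow_gaussMeasure_le`, `exists_integral_norm_pow_gaussMeasure_le` — moments of
  the isotropic Gaussian, uniformly in mean and variance;
* `lintegral_avg_norm_pow_localGibbsMeasure_le` — `∫ (N+1)⁻¹ Σᵢ |vᵢ|ⁿ dLG_N ≤ C`;
* `exists_lintegral_one_add_energy_pow_four_le` — `∫ (1 + e)^4 dLG_N ≤ C`;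
* `lintegral_one_add_energy_pow_four_flow_le` — the same at every time along the flow.

References: H. Spohn, *Large Scale Dynamics of Interacting Particles* (1991), Part I §2.3
(local equilibrium states) [Spohn1991].
-/

noncomputable section

open MeasureTheory ProbabilityTheory Set Filter Topology
open scoped ENNReal BigOperators

namespace Summit.AtomisticToContinuum.HydrodynamicLimit.Theorems

open Literature.Analysis.FluidPDE Literature.MathematicalPhysics.KineticTheory

/-! ## Gaussian moments, uniformly in mean and variance -/

/-- Moments of the isotropic Gaussian: `E|u + √θ w|ⁿ ≤ 2ⁿ⁻¹ (|u|ⁿ + √θⁿ E|w|ⁿ)`. [folklore] -/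
theorem integral_norm_pow_gaussMeasure_le (u : V3) {θ : ℝ} (hθ : 0 < θ) {n : ℕ} (hn : n ≠ 0) :
    ∫ v, ‖v‖ ^ n ∂gaussMeasure u θ ≤
      2 ^ (n - 1) * (‖u‖ ^ n + Real.sqrt θ ^ n * ∫ w, ‖w‖ ^ n ∂stdGaussian V3) := by
  rw [integral_gaussMeasure u hθ]
  have hint : Integrable (fun w : V3 => ‖w‖ ^ n) (stdGaussian V3) :=
    (IsGaussian.memLp_id _ n (by simp)).integrable_norm_pow (by exact_mod_cast hn)
  have hpt : ∀ w : V3, ‖u + Real.sqrt θ • w‖ ^ n ≤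
      2 ^ (n - 1) * (‖u‖ ^ n + Real.sqrt θ ^ n * ‖w‖ ^ n) := by
    intro w
    have h1 : ‖u + Real.sqrt θ • w‖ ≤ ‖u‖ + Real.sqrt θ * ‖w‖ := by
      calc ‖u + Real.sqrt θ • w‖ ≤ ‖u‖ + ‖Real.sqrt θ • w‖ := norm_add_le _ _
        _ = ‖u‖ + Real.sqrt θ * ‖w‖ := by
            rw [norm_smul, Real.norm_eq_abs, abs_of_nonneg (Real.sqrt_nonneg θ)]
    calc ‖u + Real.sqrt θ • w‖ ^ n ≤ (‖u‖ + Real.sqrt θ * ‖w‖) ^ n :=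
          pow_le_pow_left₀ (norm_nonneg _) h1 n
      _ ≤ 2 ^ (n - 1) * (‖u‖ ^ n + (Real.sqrt θ * ‖w‖) ^ n) :=
          add_pow_le (norm_nonneg _) (by positivity) n
      _ = 2 ^ (n - 1) * (‖u‖ ^ n + Real.sqrt θ ^ n * ‖w‖ ^ n) := by rw [mul_pow]
  have hint2 : Integrable (fun w : V3 => 2 ^ (n - 1) * (‖u‖ ^ n + Real.sqrt θ ^ n * ‖w‖ ^ n))
      (stdGaussian V3) :=
    ((integrable_const _).add (hint.const_mul _)).const_mul _
  calc ∫ w, ‖u + Real.sqrt θ • w‖ ^ n ∂stdGaussian V3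
      ≤ ∫ w, 2 ^ (n - 1) * (‖u‖ ^ n + Real.sqrt θ ^ n * ‖w‖ ^ n) ∂stdGaussian V3 :=
        integral_mono_of_nonneg (Eventually.of_forall fun w => by positivity) hint2
          (Eventually.of_forall hpt)
    _ = 2 ^ (n - 1) * (‖u‖ ^ n + Real.sqrt θ ^ n * ∫ w, ‖w‖ ^ n ∂stdGaussian V3) := by
        rw [integral_const_mul, integral_add (integrable_const _) (hint.const_mul _),
          integral_const_mul, integral_const, smul_eq_mul, probReal_univ, one_mul]

/-- Uniform moment bound: for `‖u‖ ≤ U` and `0 < θ ≤ Θ`, `E_{N(u, θ id)} |v|ⁿ ≤ C(n, U, Θ)`.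
[folklore] -/
theorem exists_integral_norm_pow_gaussMeasure_le (U Θ : ℝ) {n : ℕ} (hn : n ≠ 0) :
    ∃ C : ℝ, 0 ≤ C ∧ ∀ (u : V3) (θ : ℝ), ‖u‖ ≤ U → 0 < θ → θ ≤ Θ →
      ∫ v, ‖v‖ ^ n ∂gaussMeasure u θ ≤ C := by
  set M : ℝ := ∫ w, ‖w‖ ^ n ∂stdGaussian V3 with hM
  have hM0 : 0 ≤ M := integral_nonneg fun w => by positivity
  refine ⟨2 ^ (n - 1) * (|U| ^ n + Real.sqrt |Θ| ^ n * M), by positivity, fun u θ hu hθ hθΘ => ?_⟩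
  refine (integral_norm_pow_gaussMeasure_le u hθ hn).trans ?_
  have h1 : ‖u‖ ^ n ≤ |U| ^ n := pow_le_pow_left₀ (norm_nonneg _) (hu.trans (le_abs_self U)) n
  have h2 : Real.sqrt θ ^ n ≤ Real.sqrt |Θ| ^ n :=
    pow_le_pow_left₀ (Real.sqrt_nonneg _) (Real.sqrt_le_sqrt (hθΘ.trans (le_abs_self Θ))) n
  gcongr

/-! ## Moments of the local Gibbs laws -/

variable {a₀ θ₀ : T3 → ℝ} {u₀ : T3 → V3}

/-- **Velocity moments of the local Gibbs measure, uniformly in `N`.** For continuous profiles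
`a₀ ≥ 0`, `θ₀ > 0`, `u₀` there is `C` with `∫ (N+1)⁻¹ Σᵢ |vᵢ|ⁿ dLG_N ≤ C` for every `N` at which
`LG_N` is a probability measure (disintegration into positions and independent Gaussian
velocities, `lintegral_localGibbsMeasure`, and the uniform Gaussian moment bound). [folklore] -/
theorem lintegral_avg_norm_pow_localGibbsMeasure_le (ha : Continuous a₀) (hθ : Continuous θ₀)
    (hu : Continuous u₀) (ha0 : ∀ x, 0 ≤ a₀ x) (hθ0 : ∀ x, 0 < θ₀ x) (σ : ℝ) {n : ℕ} (hn : n ≠ 0) :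
    ∃ C : ℝ, 0 ≤ C ∧ ∀ N : ℕ, IsProbabilityMeasure (localGibbsMeasure σ a₀ u₀ θ₀ N) →
      ∫⁻ z, ENNReal.ofReal (((N + 1 : ℕ) : ℝ)⁻¹ * ∑ i, ‖(z i).2‖ ^ n)
        ∂localGibbsMeasure σ a₀ u₀ θ₀ N ≤ ENNReal.ofReal C := by
  obtain ⟨U, hU⟩ := isCompact_univ.exists_bound_of_continuousOn hu.continuousOn
  obtain ⟨Θ, hΘ⟩ := isCompact_univ.exists_bound_of_continuousOn hθ.continuousOn
  have hU' : ∀ x, ‖u₀ x‖ ≤ U := fun x => hU x (mem_univ x)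
  have hΘ' : ∀ x, θ₀ x ≤ Θ := fun x => by
    have := hΘ x (mem_univ x)
    rw [Real.norm_eq_abs] at this
    exact (le_abs_self _).trans this
  obtain ⟨C, hC0, hC⟩ := exists_integral_norm_pow_gaussMeasure_le U Θ hn
  refine ⟨C, hC0, fun N hP => ?_⟩
  have hmeas : Measurable fun z : Config (N + 1) (Fin 3) T3 =>
      ENNReal.ofReal (((N + 1 : ℕ) : ℝ)⁻¹ * ∑ i, ‖(z i).2‖ ^ n) := by
    refine (measurable_const.mul (Finset.measurable_sum _ fun i _ => ?_)).ennreal_ofReal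
    exact ((measurable_pi_apply i).snd.norm).pow_const n
  rw [lintegral_localGibbsMeasure ha hθ hu ha0 hθ0 σ N hmeas]
  have hn0 : ((N + 1 : ℕ) : ℝ≥0∞) ≠ 0 := by exact_mod_cast Nat.succ_ne_zero N
  have hnt : ((N + 1 : ℕ) : ℝ≥0∞) ≠ ∞ := ENNReal.natCast_ne_top _
  have hinner : ∀ x : Fin (N + 1) → T3,
      ∫⁻ v, ENNReal.ofReal (((N + 1 : ℕ) : ℝ)⁻¹ * ∑ i, ‖(zipConfig (x, v) i).2‖ ^ n)
        ∂velMeasure u₀ θ₀ x ≤ ENNReal.ofReal C := by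
    intro x
    have hpt : ∀ v : Fin (N + 1) → V3,
        ENNReal.ofReal (((N + 1 : ℕ) : ℝ)⁻¹ * ∑ i, ‖(zipConfig (x, v) i).2‖ ^ n) =
          ((N + 1 : ℕ) : ℝ≥0∞)⁻¹ * ∑ i, ENNReal.ofReal (‖v i‖ ^ n) := by
      intro v
      simp only [zipConfig_apply]
      rw [ENNReal.ofReal_mul (inv_nonneg.2 (Nat.cast_nonneg _)),
        ENNReal.ofReal_inv_of_pos (by exact_mod_cast Nat.succ_pos N), ENNReal.ofReal_natCast,
        ENNReal.ofReal_sum_of_nonneg fun i _ => by positivity]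
    simp_rw [hpt]
    have hmi : ∀ i : Fin (N + 1),
        Measurable fun v : Fin (N + 1) → V3 => ENNReal.ofReal (‖v i‖ ^ n) := fun i =>
      (((measurable_pi_apply i).norm).pow_const n).ennreal_ofReal
    rw [lintegral_const_mul _ (Finset.measurable_sum _ fun i _ => hmi i),
      lintegral_finsetSum _ fun i _ => hmi i]
    have hterm : ∀ i : Fin (N + 1),
        ∫⁻ v, ENNReal.ofReal (‖v i‖ ^ n) ∂velMeasure u₀ θ₀ x ≤ ENNReal.ofReal C := by
      intro i
      unfold velMeasure
      rw [(measurePreserving_eval (fun j : Fin (N + 1) => gaussMeasure (u₀ (x j)) (θ₀ (x j)))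
        i).lintegral_comp ((measurable_norm.pow_const n).ennreal_ofReal)]
      have hint : Integrable (fun w : V3 => ‖w‖ ^ n) (gaussMeasure (u₀ (x i)) (θ₀ (x i))) :=
        (IsGaussian.memLp_id _ n (by simp)).integrable_norm_pow (by exact_mod_cast hn)
      rw [← ofReal_integral_eq_lintegral_ofReal hint (Eventually.of_forall fun w => by positivity)]
      exact ENNReal.ofReal_le_ofReal (hC _ _ (hU' _) (hθ0 _) (hΘ' _))
    calc ((N + 1 : ℕ) : ℝ≥0∞)⁻¹ * ∑ i, ∫⁻ v, ENNReal.ofReal (‖v i‖ ^ n) ∂velMeasure u₀ θ₀ x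
        ≤ ((N + 1 : ℕ) : ℝ≥0∞)⁻¹ * ∑ _i : Fin (N + 1), ENNReal.ofReal C := by
          gcongr with i
          exact hterm i
      _ = ENNReal.ofReal C := by
          rw [Finset.sum_const, Finset.card_univ, Fintype.card_fin, nsmul_eq_mul, ← mul_assoc,
            ENNReal.inv_mul_cancel hn0 hnt, one_mul]
  have hρm : Measurable fun x : Fin (N + 1) → T3 => ENNReal.ofReal
      ((canonicalPartition (Torus.geometry (Fin 3)) (hsDiameter σ N) (N + 1)
        (localGibbsProfile a₀ u₀ θ₀))⁻¹ * posWeight a₀ (hsDiameter σ N) (N + 1) x) :=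
    (measurable_const.mul (measurable_posWeight ha _ _)).ennreal_ofReal
  calc ∫⁻ x, ENNReal.ofReal ((canonicalPartition (Torus.geometry (Fin 3)) (hsDiameter σ N) (N + 1)
          (localGibbsProfile a₀ u₀ θ₀))⁻¹ * posWeight a₀ (hsDiameter σ N) (N + 1) x) *
        ∫⁻ v, ENNReal.ofReal (((N + 1 : ℕ) : ℝ)⁻¹ * ∑ i, ‖(zipConfig (x, v) i).2‖ ^ n)
          ∂velMeasure u₀ θ₀ x
      ≤ ∫⁻ x, ENNReal.ofReal ((canonicalPartition (Torus.geometry (Fin 3)) (hsDiameter σ N) (N + 1)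
          (localGibbsProfile a₀ u₀ θ₀))⁻¹ * posWeight a₀ (hsDiameter σ N) (N + 1) x) *
          ENNReal.ofReal C :=
        lintegral_mono fun x => mul_le_mul_right (hinner x) _
    _ = ENNReal.ofReal C := by
        rw [lintegral_mul_const _ hρm, lintegral_posWeight_eq_one ha hθ hu ha0 hθ0 σ N, one_mul]

/-- Pointwise: `(1 + e)^4 ≤ 8 + 8 (N+1)⁻¹ Σᵢ |vᵢ|⁸` for the kinetic energy per particle
`e = (N+1)⁻¹ Σᵢ |vᵢ|²` (convexity twice: `(1+e)^4 ≤ 2³(1 + e^4)` and the power-mean inequality).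
[folklore] -/
theorem one_add_avg_sq_pow_four_le {N : ℕ} (z : Config (N + 1) (Fin 3) T3) :
    (1 + ((N + 1 : ℕ) : ℝ)⁻¹ * ∑ i, ‖(z i).2‖ ^ 2) ^ 4 ≤
      8 + 8 * (((N + 1 : ℕ) : ℝ)⁻¹ * ∑ i, ‖(z i).2‖ ^ 8) := by
  set e : ℝ := ((N + 1 : ℕ) : ℝ)⁻¹ * ∑ i, ‖(z i).2‖ ^ 2 with he
  have he0 : 0 ≤ e := by positivity
  have h1 : (1 + e) ^ 4 ≤ 2 ^ (4 - 1) * (1 ^ 4 + e ^ 4) := add_pow_le zero_le_one he0 4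
  have h2 : e ^ 4 ≤ ((N + 1 : ℕ) : ℝ)⁻¹ * ∑ i, ‖(z i).2‖ ^ 8 := by
    have hw : ∑ _i : Fin (N + 1), ((N + 1 : ℕ) : ℝ)⁻¹ = 1 := by
      rw [Finset.sum_const, Finset.card_univ, Fintype.card_fin, nsmul_eq_mul,
        mul_inv_cancel₀ (by exact_mod_cast Nat.succ_ne_zero N)]
    have h := Real.pow_arith_mean_le_arith_mean_pow Finset.univ (fun _ => ((N + 1 : ℕ) : ℝ)⁻¹)
      (fun i => ‖(z i).2‖ ^ 2) (fun _ _ => by positivity) hw (fun _ _ => by positivity) 4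
    rw [he, Finset.mul_sum]
    refine le_of_le_of_eq h ?_
    rw [Finset.mul_sum]
    refine Finset.sum_congr rfl fun i _ => ?_
    ring
  calc (1 + e) ^ 4 ≤ 2 ^ (4 - 1) * (1 ^ 4 + e ^ 4) := h1
    _ = 8 + 8 * e ^ 4 := by norm_num; ring
    _ ≤ 8 + 8 * (((N + 1 : ℕ) : ℝ)⁻¹ * ∑ i, ‖(z i).2‖ ^ 8) := by gcongr

/-- **Fourth moment of `1 + e` under the local Gibbs measure, uniformly in `N`** (`σ ≤ 1/2`, so
that the local Gibbs measures are probability measures): `∫ (1 + e)^4 dLG_N ≤ C`. [folklore] -/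
theorem exists_lintegral_one_add_energy_pow_four_le (ha : Continuous a₀) (hθ : Continuous θ₀)
    (hu : Continuous u₀) (ha0 : ∀ x, 0 < a₀ x) (hθ0 : ∀ x, 0 < θ₀ x) {σ : ℝ} (hσ : σ ≤ 1 / 2) :
    ∃ C : ℝ, 0 ≤ C ∧ ∀ N : ℕ,
      ∫⁻ z, ENNReal.ofReal ((1 + ((N + 1 : ℕ) : ℝ)⁻¹ * ∑ i, ‖(z i).2‖ ^ 2) ^ 4)
        ∂localGibbsMeasure σ a₀ u₀ θ₀ N ≤ ENNReal.ofReal C := by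
  obtain ⟨C, hC0, hC⟩ := lintegral_avg_norm_pow_localGibbsMeasure_le ha hθ hu
    (fun x => (ha0 x).le) hθ0 σ (n := 8) (by norm_num)
  refine ⟨8 + 8 * C, by positivity, fun N => ?_⟩
  haveI := isProbabilityMeasure_localGibbsMeasure ha hθ hu ha0 hθ0 hσ N
  have hmeas : Measurable fun z : Config (N + 1) (Fin 3) T3 =>
      ENNReal.ofReal (((N + 1 : ℕ) : ℝ)⁻¹ * ∑ i, ‖(z i).2‖ ^ 8) := by
    refine (measurable_const.mul (Finset.measurable_sum _ fun i _ => ?_)).ennreal_ofReal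
    exact ((measurable_pi_apply i).snd.norm).pow_const 8
  calc ∫⁻ z, ENNReal.ofReal ((1 + ((N + 1 : ℕ) : ℝ)⁻¹ * ∑ i, ‖(z i).2‖ ^ 2) ^ 4)
        ∂localGibbsMeasure σ a₀ u₀ θ₀ N
      ≤ ∫⁻ z, ENNReal.ofReal 8 + ENNReal.ofReal 8 *
          ENNReal.ofReal (((N + 1 : ℕ) : ℝ)⁻¹ * ∑ i, ‖(z i).2‖ ^ 8)
          ∂localGibbsMeasure σ a₀ u₀ θ₀ N := by
        refine lintegral_mono fun z => ?_
        rw [← ENNReal.ofReal_mul (by norm_num), ← ENNReal.ofReal_add (by norm_num) (by positivity)]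
        exact ENNReal.ofReal_le_ofReal (one_add_avg_sq_pow_four_le z)
    _ = ENNReal.ofReal 8 + ENNReal.ofReal 8 *
          ∫⁻ z, ENNReal.ofReal (((N + 1 : ℕ) : ℝ)⁻¹ * ∑ i, ‖(z i).2‖ ^ 8)
            ∂localGibbsMeasure σ a₀ u₀ θ₀ N := by
        rw [lintegral_add_left measurable_const, lintegral_const, measure_univ, mul_one,
          lintegral_const_mul _ hmeas]
    _ ≤ ENNReal.ofReal 8 + ENNReal.ofReal 8 * ENNReal.ofReal C := by
        gcongr
        exact hC N inferInstance
    _ = ENNReal.ofReal (8 + 8 * C) := by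
        rw [← ENNReal.ofReal_mul (by norm_num), ← ENNReal.ofReal_add (by norm_num) (by positivity)]

/-- **The moment bound at every time along a hard-sphere flow.** Kinetic energy is conserved on
the good set (`HardSphereFlow.configEnergy_flow`), which carries the local Gibbs law
(`localGibbsMeasure_absolutelyContinuous`), so `∫ (1 + e(Φ_t z))^4 dP_N(z) ≤ C` for all `N`, all
flows and all times, with the constant of `exists_lintegral_one_add_energy_pow_four_le`.
[folklore] -/
theorem lintegral_one_add_energy_pow_four_flow_le (ha : Continuous a₀) (hθ : Continuous θ₀)
    (hu : Continuous u₀) (ha0 : ∀ x, 0 < a₀ x) (hθ0 : ∀ x, 0 < θ₀ x) {σ : ℝ} (hσ : σ ≤ 1 / 2) :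
    ∃ C : ℝ, 0 ≤ C ∧ ∀ (N : ℕ)
      (Φ : HardSphereFlow (Torus.geometry (Fin 3)) (hsDiameter σ N) (N + 1)) (t : ℝ) (k : ℕ),
      k ≤ 4 →
      ∫⁻ z, ENNReal.ofReal ((1 + ((N + 1 : ℕ) : ℝ)⁻¹ * ∑ i, ‖(Φ.flow t z i).2‖ ^ 2) ^ k)
        ∂localGibbsLaw σ a₀ u₀ θ₀ N Φ ≤ ENNReal.ofReal C := by
  obtain ⟨C, hC0, hC⟩ := exists_lintegral_one_add_energy_pow_four_le ha hθ hu ha0 hθ0 hσ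
  refine ⟨C, hC0, fun N Φ t k hk => ?_⟩
  have hgood : ∀ᵐ z ∂localGibbsMeasure σ a₀ u₀ θ₀ N, z ∈ Φ.good :=
    (localGibbsMeasure_absolutelyContinuous σ a₀ u₀ θ₀ N Φ).ae_le Φ.ae_mem_good
  have hsum : ∀ w : Config (N + 1) (Fin 3) T3, ∑ i, ‖(w i).2‖ ^ 2 = 2 * configEnergy w := by
    intro w
    rw [configEnergy, ← mul_assoc]
    norm_num
  rw [localGibbsLaw_eq]
  calc ∫⁻ z, ENNReal.ofReal ((1 + ((N + 1 : ℕ) : ℝ)⁻¹ * ∑ i, ‖(Φ.flow t z i).2‖ ^ 2) ^ k)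
        ∂localGibbsMeasure σ a₀ u₀ θ₀ N
      = ∫⁻ z, ENNReal.ofReal ((1 + ((N + 1 : ℕ) : ℝ)⁻¹ * ∑ i, ‖(z i).2‖ ^ 2) ^ k)
        ∂localGibbsMeasure σ a₀ u₀ θ₀ N := by
        refine lintegral_congr_ae ?_
        filter_upwards [hgood] with z hz
        rw [hsum, hsum, Φ.configEnergy_flow hz t]
    _ ≤ ∫⁻ z, ENNReal.ofReal ((1 + ((N + 1 : ℕ) : ℝ)⁻¹ * ∑ i, ‖(z i).2‖ ^ 2) ^ 4)
        ∂localGibbsMeasure σ a₀ u₀ θ₀ N := by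
        refine lintegral_mono fun z => ENNReal.ofReal_le_ofReal ?_
        have h1 : (1 : ℝ) ≤ 1 + ((N + 1 : ℕ) : ℝ)⁻¹ * ∑ i, ‖(z i).2‖ ^ 2 :=
          le_add_of_nonneg_right (by positivity)
        exact pow_le_pow_right₀ h1 hk
    _ ≤ ENNReal.ofReal C := hC N

end Summit.AtomisticToContinuum.HydrodynamicLimit.Theorems

end
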